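import Mathlib

/-!
# Crux `LevyNegativeMoment` (stmt-AtomisticToContinuum-9115), line `registered`, stub `stub_rieszSum` —
# part A: Abel summation against a character of `ℤ/m`

Helper file (lead prover of the line) for the L-free grid Riesz sum bound
`|Σ_{q≢0} cos(2π q·j/m)/‖q̄‖| ≤ A·m²/(1+‖j̄‖²)` (registered stub `stub_rieszSum` of the birth skeleton
`Cruxes/LevyNegativeMoment/Lines/birth.lean`).  The bound is proved one coordinate at a time: the sum over the
distinguished coordinate `t ∈ ℤ/m` against the character `ζ^t`, `ζ = exp(2πi j/m)`, is controlled by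

* a FIRST-order Abel transformation over a full period (`abel1`: the complete character sum vanishes, so only
  the total variation of the amplitude enters), and
* a cyclic SECOND-order transformation followed by a THIRD cyclic step on the smooth part of the second
  difference (`cyclic_abel23_bound`: the kink of the periodised amplitude at the zone boundary is kept at second
  order, the smooth part gains a third factor `‖ζ⁻¹ - 1‖⁻¹`).

This file is pure algebra/trigonometry: the geometric-sum bound `‖Σ_{t<n} ζ^t‖ ≤ 2/‖ζ-1‖`, the two Abel
bounds, and the character facts `‖ζ‖ = 1`, `ζ^m = 1`, `‖ζ - 1‖ = ‖ζ⁻¹ - 1‖ = 2|sin(πj/m)| ≥ 4 j̄/m`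
(`j̄ = min(j, m-j)`, Jordan's inequality).
-/

namespace Summit.AtomisticToContinuum.BoseEinsteinCondensation.Cruxes.LevyNegativeMoment.Birth.Riesz

open scoped BigOperators
open Finset

/-! ## Geometric sums of a unimodular `ζ ≠ 1` -/

/-- Partial geometric sums of a unimodular `ζ ≠ 1` are bounded by `2/‖ζ - 1‖`. [folklore] -/
theorem norm_geom_sum_le {ζ : ℂ} (hζ : ‖ζ‖ = 1) (hζ1 : ζ ≠ 1) (n : ℕ) :
    ‖∑ t ∈ range n, ζ ^ t‖ ≤ 2 / ‖ζ - 1‖ := by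
  rw [geom_sum_eq hζ1, norm_div]
  have h : ‖ζ ^ n - 1‖ ≤ 2 :=
    calc ‖ζ ^ n - 1‖ ≤ ‖ζ ^ n‖ + ‖(1 : ℂ)‖ := norm_sub_le _ _
      _ = 2 := by rw [norm_pow, hζ, one_pow, norm_one]; norm_num
  gcongr

/-- Over a full period the character sum vanishes: `ζ^m = 1`, `ζ ≠ 1` ⇒ `Σ_{t<m} ζ^t = 0`. [folklore] -/
theorem geom_sum_period {ζ : ℂ} (hζ1 : ζ ≠ 1) {m : ℕ} (hm : ζ ^ m = 1) :
    ∑ t ∈ range m, ζ ^ t = 0 := by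
  rw [geom_sum_eq hζ1, hm, sub_self, zero_div]

/-! ## First-order Abel bound over a full period -/

/-- First-order Abel bound over a full period: if `ζ^m = 1`, `ζ ≠ 1`, `‖ζ‖ = 1` then
`‖Σ_{t<m} F t · ζ^t‖ ≤ (2/‖ζ-1‖) Σ_{t<m-1} |F(t+1) - F t|` (the boundary term vanishes because the complete
character sum does). [folklore] -/
theorem abel1 {ζ : ℂ} (hζ : ‖ζ‖ = 1) (hζ1 : ζ ≠ 1) {m : ℕ} (hm : ζ ^ m = 1) (F : ℕ → ℝ) :
    ‖∑ t ∈ range m, (F t : ℂ) * ζ ^ t‖ ≤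
      2 / ‖ζ - 1‖ * ∑ t ∈ range (m - 1), |F (t + 1) - F t| := by
  have key := Finset.sum_range_by_parts (fun t => (F t : ℂ)) (fun t => ζ ^ t) m
  simp only [smul_eq_mul] at key
  rw [key, geom_sum_period hζ1 hm, mul_zero, zero_sub, norm_neg]
  calc ‖∑ i ∈ range (m - 1), ((F (i + 1) : ℂ) - F i) * ∑ j ∈ range (i + 1), ζ ^ j‖
      ≤ ∑ i ∈ range (m - 1), ‖((F (i + 1) : ℂ) - F i) * ∑ j ∈ range (i + 1), ζ ^ j‖ :=
        norm_sum_le _ _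
    _ ≤ ∑ i ∈ range (m - 1), |F (i + 1) - F i| * (2 / ‖ζ - 1‖) := by
        refine sum_le_sum fun i _ => ?_
        rw [norm_mul, ← Complex.ofReal_sub, Complex.norm_real, Real.norm_eq_abs]
        exact mul_le_mul_of_nonneg_left (norm_geom_sum_le hζ hζ1 _) (abs_nonneg _)
    _ = 2 / ‖ζ - 1‖ * ∑ t ∈ range (m - 1), |F (t + 1) - F t| := by
        rw [← sum_mul, mul_comm]

/-! ## Cyclic Abel transformations -/

/-- Cyclic shift against a character: for `F` with `F m = F 0` and `ζ^m = 1`,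
`Σ_{t<m} ζ^t F(t+1) = ζ⁻¹ Σ_{t<m} ζ^t F t`. [folklore] -/
theorem cyclic_shift {ζ : ℂ} (hζ0 : ζ ≠ 0) {m : ℕ} (hm : ζ ^ m = 1) {F : ℕ → ℂ} (hF : F m = F 0) :
    ∑ t ∈ range m, ζ ^ t * F (t + 1) = ζ⁻¹ * ∑ t ∈ range m, ζ ^ t * F t := by
  have h1 : ∑ t ∈ range m, ζ ^ t * F (t + 1) = ζ⁻¹ * ∑ t ∈ range m, ζ ^ (t + 1) * F (t + 1) := by
    rw [mul_sum]
    refine sum_congr rfl fun t _ => ?_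
    rw [pow_succ]
    field_simp
  rw [h1]
  congr 1
  have h2 := Finset.sum_range_succ' (fun t => ζ ^ t * F t) m
  have h3 := Finset.sum_range_succ (fun t => ζ ^ t * F t) m
  rw [hm, hF, one_mul] at h3
  rw [pow_zero, one_mul] at h2
  linear_combination h3 - h2

/-- Two cyclic shifts: `(ζ⁻¹ - 1)² Σ ζ^t F t = Σ ζ^t (F(t+2) - 2F(t+1) + F t)` for `m`-periodic `F`.
[folklore] -/
theorem cyclic_abel2 {ζ : ℂ} (hζ0 : ζ ≠ 0) {m : ℕ} (hm : ζ ^ m = 1) {F : ℕ → ℂ}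
    (hF : ∀ t, F (t + m) = F t) :
    (ζ⁻¹ - 1) ^ 2 * ∑ t ∈ range m, ζ ^ t * F t =
      ∑ t ∈ range m, ζ ^ t * (F (t + 2) - 2 * F (t + 1) + F t) := by
  have s1 := cyclic_shift hζ0 hm (F := F) (by simpa using hF 0)
  have hF1 : F (m + 1) = F 1 := by simpa [add_comm] using hF 1
  have s2 := cyclic_shift hζ0 hm (F := fun t => F (t + 1)) hF1
  have e : ∑ t ∈ range m, ζ ^ t * (F (t + 2) - 2 * F (t + 1) + F t)
      = ∑ t ∈ range m, ζ ^ t * F (t + 1 + 1) - 2 * ∑ t ∈ range m, ζ ^ t * F (t + 1)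
          + ∑ t ∈ range m, ζ ^ t * F t := by
    rw [mul_sum, ← sum_sub_distrib, ← sum_add_distrib]
    refine sum_congr rfl fun t _ => ?_
    ring_nf
  rw [e, s2, s1]
  ring

/-- Cyclic Abel bound of orders two and three with a split second difference.  If `F`, `a` are `m`-periodic,
`F(t+2) - 2F(t+1) + F t = a t + b t` for all `t`, and `ζ^m = 1`, `‖ζ‖ = 1`, `ζ ≠ 1`, then
`‖Σ_{t<m} ζ^t F t‖ ≤ ‖ζ⁻¹-1‖⁻³ Σ_{t<m} |a(t+1) - a t| + ‖ζ⁻¹-1‖⁻² Σ_{t<m} |b t|`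
(two cyclic steps on `F`, a third one on the part `a` only). [folklore] -/
theorem cyclic_abel23_bound {ζ : ℂ} (hζ : ‖ζ‖ = 1) (hζ1 : ζ ≠ 1) {m : ℕ} (hm : ζ ^ m = 1)
    {F a b : ℕ → ℝ} (hF : ∀ t, F (t + m) = F t) (ha : ∀ t, a (t + m) = a t)
    (hab : ∀ t, F (t + 2) - 2 * F (t + 1) + F t = a t + b t) :
    ‖∑ t ∈ range m, ζ ^ t * (F t : ℂ)‖ ≤
      ‖ζ⁻¹ - 1‖⁻¹ ^ 3 * ∑ t ∈ range m, |a (t + 1) - a t| +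
        ‖ζ⁻¹ - 1‖⁻¹ ^ 2 * ∑ t ∈ range m, |b t| := by
  have hζ0 : ζ ≠ 0 := by
    intro h; rw [h, norm_zero] at hζ; exact zero_ne_one hζ
  have hw : ζ⁻¹ - 1 ≠ 0 := by
    intro h
    apply hζ1
    have h' : ζ⁻¹ = 1 := sub_eq_zero.mp h
    exact inv_eq_one.mp h'
  set w : ℂ := ζ⁻¹ - 1 with hw_def
  set S : ℂ := ∑ t ∈ range m, ζ ^ t * (F t : ℂ) with hS
  set Aa : ℂ := ∑ t ∈ range m, ζ ^ t * (a t : ℂ) with hAa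
  set Bb : ℂ := ∑ t ∈ range m, ζ ^ t * (b t : ℂ) with hBb
  set Da : ℂ := ∑ t ∈ range m, ζ ^ t * ((a (t + 1) : ℂ) - a t) with hDa
  have h2 := cyclic_abel2 hζ0 hm (F := fun t => (F t : ℂ)) (fun t => by exact_mod_cast hF t)
  have h2' : w ^ 2 * S = Aa + Bb := by
    rw [hw_def, hS, h2, hAa, hBb, ← sum_add_distrib]
    refine sum_congr rfl fun t _ => ?_
    rw [← mul_add]
    congr 1
    exact_mod_cast hab t
  have ham : (a m : ℂ) = a 0 := by exact_mod_cast (by simpa using ha 0)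
  have h3 := cyclic_shift hζ0 hm (F := fun t => (a t : ℂ)) ham
  have h3' : w * Aa = Da := by
    rw [hw_def, hAa, hDa, sub_mul, one_mul, ← h3, ← sum_sub_distrib]
    refine sum_congr rfl fun t _ => ?_
    ring
  have eS : S = w⁻¹ ^ 3 * Da + w⁻¹ ^ 2 * Bb := by
    have e1 : S = w⁻¹ ^ 2 * (Aa + Bb) := by
      rw [← h2']; field_simp
    have e2 : Aa = w⁻¹ * Da := by
      rw [← h3']; field_simp
    rw [e1, e2]
    ring
  have nD : ‖Da‖ ≤ ∑ t ∈ range m, |a (t + 1) - a t| := by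
    rw [hDa]
    refine (norm_sum_le _ _).trans (le_of_eq (sum_congr rfl fun t _ => ?_))
    rw [norm_mul, norm_pow, hζ, one_pow, one_mul, ← Complex.ofReal_sub, Complex.norm_real,
      Real.norm_eq_abs]
  have nB : ‖Bb‖ ≤ ∑ t ∈ range m, |b t| := by
    rw [hBb]
    refine (norm_sum_le _ _).trans (le_of_eq (sum_congr rfl fun t _ => ?_))
    rw [norm_mul, norm_pow, hζ, one_pow, one_mul, Complex.norm_real, Real.norm_eq_abs]
  calc ‖S‖ = ‖w⁻¹ ^ 3 * Da + w⁻¹ ^ 2 * Bb‖ := by rw [eS]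
    _ ≤ ‖w⁻¹ ^ 3 * Da‖ + ‖w⁻¹ ^ 2 * Bb‖ := norm_add_le _ _
    _ = ‖w‖⁻¹ ^ 3 * ‖Da‖ + ‖w‖⁻¹ ^ 2 * ‖Bb‖ := by
        rw [norm_mul, norm_mul, norm_pow, norm_pow, norm_inv]
    _ ≤ ‖w‖⁻¹ ^ 3 * ∑ t ∈ range m, |a (t + 1) - a t| + ‖w‖⁻¹ ^ 2 * ∑ t ∈ range m, |b t| := by
        gcongr

/-! ## The character `ζ = exp(2πi j/m)` -/

/-- The character value `ζ_{m,j} = exp(2πi·j/m)` of `ℤ/m` at the frequency `j` (a notation, not a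
definition, so that this helper file stays in the kernel-reviewed proof lane). -/
scoped notation3 "ζ⟦" m "," j "⟧" =>
  Complex.exp (Complex.I * (((2 : ℝ) * Real.pi * ((j : ℕ) : ℝ) / ((m : ℕ) : ℝ) : ℝ) : ℂ))

/-- `ζ_{m,j}^t = exp(i·2π j t/m)`. [folklore] -/
theorem zeta_pow (m j t : ℕ) :
    ζ⟦m,j⟧ ^ t = Complex.exp (Complex.I * ((2 * Real.pi * j * t / m : ℝ) : ℂ)) := by
  rw [← Complex.exp_nat_mul]
  congr 1
  push_cast
  ring

/-- `‖ζ_{m,j}‖ = 1`. [folklore] -/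
theorem norm_zeta (m j : ℕ) : ‖ζ⟦m,j⟧‖ = 1 := by
  rw [mul_comm, Complex.norm_exp_ofReal_mul_I]

/-- `ζ_{m,j}^m = 1`. [folklore] -/
theorem zeta_pow_self (m j : ℕ) (hm : m ≠ 0) : ζ⟦m,j⟧ ^ m = 1 := by
  rw [zeta_pow]
  have : (2 * Real.pi * j * m / m : ℝ) = (j : ℝ) * (2 * Real.pi) := by
    field_simp
  rw [this]
  have h := Complex.exp_nat_mul_two_pi_mul_I j
  convert h using 2
  push_cast
  ring

/-- `‖ζ_{m,j} - 1‖ = 2|sin(π j/m)|`. [folklore] -/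
theorem norm_zeta_sub_one (m j : ℕ) : ‖ζ⟦m,j⟧ - 1‖ = 2 * |Real.sin (Real.pi * j / m)| := by
  rw [Complex.norm_exp_I_mul_ofReal_sub_one, Real.norm_eq_abs, abs_mul, abs_two]
  congr 2
  ring

/-- `‖ζ⁻¹ - 1‖ = ‖ζ - 1‖` for unimodular `ζ`. [folklore] -/
theorem norm_inv_sub_one {ζ : ℂ} (hζ : ‖ζ‖ = 1) : ‖ζ⁻¹ - 1‖ = ‖ζ - 1‖ := by
  have hζ0 : ζ ≠ 0 := by
    intro h; rw [h, norm_zero] at hζ; exact zero_ne_one hζ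
  have : ζ⁻¹ - 1 = -(ζ⁻¹ * (ζ - 1)) := by field_simp; ring
  rw [this, norm_neg, norm_mul, norm_inv, hζ, inv_one, one_mul]

/-- Jordan's inequality on the circle: for `j < m`, `2·j̄/m ≤ |sin(π j/m)|` with `j̄ = min(j, m - j)`.
[folklore] -/
theorem two_mul_bar_div_le_abs_sin {m j : ℕ} (hj : j < m) :
    2 * (min j (m - j) : ℕ) / (m : ℝ) ≤ |Real.sin (Real.pi * j / m)| := by
  have hm : (0 : ℝ) < m := by exact_mod_cast (Nat.zero_lt_of_lt hj)
  have hjm : (j : ℝ) ≤ m := by exact_mod_cast hj.le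
  rcases le_total j (m - j) with h | h
  · rw [min_eq_left h]
    have hj2 : 2 * (j : ℝ) ≤ m := by
      have : j + j ≤ m := by omega
      exact_mod_cast (by linarith : (2 * j : ℕ) ≤ m)
    have hx0 : 0 ≤ Real.pi * j / m := by positivity
    have hx1 : Real.pi * j / m ≤ Real.pi / 2 := by
      rw [div_le_div_iff₀ hm (by norm_num : (0:ℝ) < 2)]
      nlinarith [Real.pi_pos]
    have hJ := Real.mul_le_sin hx0 hx1
    rw [abs_of_nonneg (Real.sin_nonneg_of_nonneg_of_le_pi hx0 (by linarith [Real.pi_pos]))]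
    calc 2 * (j : ℝ) / m = 2 / Real.pi * (Real.pi * j / m) := by field_simp
      _ ≤ Real.sin (Real.pi * j / m) := hJ
  · rw [min_eq_right h]
    have hsub : ((m - j : ℕ) : ℝ) = m - j := by push_cast [Nat.cast_sub hj.le]; ring
    rw [hsub]
    have hj2 : 2 * ((m : ℝ) - j) ≤ m := by
      have : (m - j) + (m - j) ≤ m := by omega
      have : 2 * (m - j) ≤ m := by omega
      have h' : ((2 * (m - j) : ℕ) : ℝ) ≤ m := by exact_mod_cast this
      push_cast [Nat.cast_sub hj.le] at h'
      linarith
    have hx0 : 0 ≤ Real.pi * (m - j) / m := by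
      apply div_nonneg _ hm.le
      exact mul_nonneg Real.pi_pos.le (by linarith)
    have hx1 : Real.pi * (m - j) / m ≤ Real.pi / 2 := by
      rw [div_le_div_iff₀ hm (by norm_num : (0:ℝ) < 2)]
      nlinarith [Real.pi_pos]
    have hJ := Real.mul_le_sin hx0 hx1
    have hper : Real.sin (Real.pi * j / m) = Real.sin (Real.pi * (m - j) / m) := by
      rw [← Real.sin_pi_sub]
      congr 1
      field_simp
    rw [hper, abs_of_nonneg (Real.sin_nonneg_of_nonneg_of_le_pi hx0 (by linarith [Real.pi_pos]))]
    calc 2 * ((m : ℝ) - j) / m = 2 / Real.pi * (Real.pi * (m - j) / m) := by field_simp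
      _ ≤ Real.sin (Real.pi * (m - j) / m) := hJ

/-- The gain factor of one Abel step: `‖ζ_{m,j} - 1‖⁻¹ ≤ m/(4 j̄)` for `0 < j̄`, `j̄ = min(j, m-j)`. [folklore] -/
theorem inv_norm_zeta_sub_one_le {m j : ℕ} (hj : j < m) (hbar : 0 < min j (m - j)) :
    ‖ζ⟦m,j⟧ - 1‖⁻¹ ≤ (m : ℝ) / (4 * (min j (m - j) : ℕ)) := by
  have hm : (0 : ℝ) < m := by exact_mod_cast (Nat.zero_lt_of_lt hj)
  have hb : (0 : ℝ) < (min j (m - j) : ℕ) := by exact_mod_cast hbar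
  have h := two_mul_bar_div_le_abs_sin hj
  rw [norm_zeta_sub_one]
  have hpos : 0 < 2 * (min j (m - j) : ℕ) / (m : ℝ) := by positivity
  rw [inv_eq_one_div, div_le_div_iff₀ (by linarith) (by positivity)]
  calc 1 * (4 * ((min j (m - j) : ℕ) : ℝ)) = (2 * (min j (m - j) : ℕ) / (m : ℝ)) * (2 * m) := by
        field_simp
        norm_num
    _ ≤ |Real.sin (Real.pi * j / m)| * (2 * m) := by gcongr
    _ = m * (2 * |Real.sin (Real.pi * j / m)|) := by ring

end Summit.AtomisticToContinuum.BoseEinsteinCondensation.Cruxes.LevyNegativeMoment.Birth.Riesz
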